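import Summits.PneNP.PneNP.Theorems.SzkEntropyPeaWorstToAvgDualModeCompileCompileSym

/-!
# Route SzkEntropy, crux `PeaWorstToAvg` (stmt-PneNP-10777), line `dual-mode-compile`, stub `stub_compile` — II:
# perfectness of the compiled map and the entropy of the compiled `PEA` instance

Second file of the AIK compile `BPEA ≤ₚ PEA 3` (`stub_compile`), on top of the objects of file I
(`SzkEntropyPeaWorstToAvgDualModeCompileCompileSym.lean`: `symHess`, `tgtBP`, `blockBP`, `compileAux`, `compileInst`).

§1 Degree `≤ 3` of the compiled map (`length_le_three_compileAux`) and **perfectness** from the one-block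
perfectness hypothesis `hblock` of `stub_compile` (kept as an explicit hypothesis — it is the statement of the
sibling stub `stub_blockPerf`, not a global fact): `perfExt_blockBP` (the empty program by
`compile_perfExt_of_const`), and `perfExt_compileAux` — `(compileAux n Ps).2` is a perfect extension of
`v ↦ Ps.map (tgtBP · v)` with fresh variables `[n, (compileAux n Ps).1)` — by the tree's concatenation rule
`RandPoly.PerfExt.append`.

§2 `compile_entropy_toFinMap_of_perfExt` — the tree's entropy-shift theorem `RandPoly.entropy_toFinMap_of_perfExt`
(`H(P'(U_{n+m})) = H(P(U_n)) + m` for a perfect extension) with the SOURCE map generalised from a sparse polynomial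
map to an arbitrary `g : (Fin n → ZMod 2) → β` read off the prefix by the valuation-level target
(`f (valOf (y ++ s)) = g y`; the same fibre bijection, `compile_card_fiber_eq_of_perfExt`); `tgtBP_natBP`,
`map_tgtBP_valOf_append` (the targets of the presented programs ARE the program values); `degLE_compileInst`,
`entropy_compileInst` (`H(p̂(U_{ℓ+s})) = H(F(U_ℓ)) + s` EXACTLY), and the membership transfer
`compileInst_mem_yes` / `compileInst_mem_no` (threshold shifted by the integer `s`).

References: Y. Ishai, E. Kushilevitz, ICALP 2002, §3; B. Applebaum, Y. Ishai, E. Kushilevitz, SIAM J. Comput. 36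
(2006), §4 (concatenation of perfect randomized encodings), §4.2; Z. Dvir, D. Gutfreund, G. Rothblum, S. Vadhan,
ICS 2011, Thm. 4.5–4.6 (proof: `H(p̂(U)) = H(p(U)) + |r|` for a perfect encoding).
-/

namespace Summit.PneNP.PneNP.Cruxes.PeaWorstToAvg.DualModeCompile

open Finset
open Literature.InformationTheory.Entropy (fiber mem_fiber mapEntropy)
open Literature.Computability.Complexity
open Literature.Computability.Complexity.RandPoly (evalP evalM pos AgreeBelow VarsIn PerfExt varsIn_append
  perfExt_nil valOf toFinMap natOf_toFinMap eval_eq_evalM valOf_append_of_lt valOf_append_add agreeBelow_valOf_append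
  evalM_congr_of_varsIn mem_toFinMap mapEntropy_eq_add_of_card_fiber)

set_option linter.dupNamespace false -- `Summit.PneNP.PneNP.…`: summit = sub-problem name (D-0017 single-conjunct layout)

/-! ### Degree of the compiled map -/

/-- **Degree of the block of one program**: every monomial has length `≤ 3`. [cite: IshaiKushilevitz2002, §3] -/
theorem length_le_three_blockBP {n : ℕ} {P : List (List (Bool × List ℕ))} {q : List (List ℕ)} (hq : q ∈ blockBP n P)
    {μ : List ℕ} (hμ : μ ∈ q) : μ.length ≤ 3 := by
  unfold blockBP at hq
  cases P with
  | nil =>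
    simp only [List.isEmpty_nil, ↓reduceIte, List.mem_singleton] at hq
    subst hq
    simp only [List.mem_singleton] at hμ
    subst hμ
    simp
  | cons r rs =>
    simp only [List.isEmpty_cons, Bool.false_eq_true, ↓reduceIte] at hq
    exact compile_length_le_three_blockOf (length_le_one_symHess _) hq hμ

/-- **Degree of the compiled map**: every monomial has length `≤ 3`. [cite: IshaiKushilevitz2002, §3] -/
theorem length_le_three_compileAux (n : ℕ) (Ps : List (List (List (Bool × List ℕ)))) {q : List (List ℕ)}
    (hq : q ∈ (compileAux n Ps).2) {μ : List ℕ} (hμ : μ ∈ q) : μ.length ≤ 3 := by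
  induction Ps generalizing n with
  | nil => exact absurd hq List.not_mem_nil
  | cons P Ps ih =>
    change q ∈ blockBP n P ++ _ at hq
    rcases List.mem_append.1 hq with hq | hq
    · exact length_le_three_blockBP hq hμ
    · exact ih _ hq

/-! ### Perfectness -/

/-- A block without variables is a perfect extension of a constant target with no fresh variables (the empty
program: output the constant polynomial `1`). [folklore] -/
theorem compile_perfExt_of_const {β : Type} {n : ℕ} {O : List (List (List ℕ))} {f : (ℕ → ZMod 2) → β}
    (hf : ∀ v w, f v = f w) (hO : ∀ v w : ℕ → ZMod 2, evalM v O = evalM w O) : PerfExt n n O f :=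
  ⟨fun _ _ h _ => h, fun v w _ => hf v w, fun v w _ => ⟨w, RandPoly.AgreeBelow.refl w, hO w v⟩⟩

/-- The target of a presented program depends only on the variables of its labels. [folklore] -/
theorem tgtBP_congr {n : ℕ} {P : List (List (Bool × List ℕ))} (hP : ∀ row ∈ P, ∀ a ∈ row, ∀ x ∈ a.2, x < n)
    {v w : ℕ → ZMod 2} (hvw : AgreeBelow n v w) : tgtBP P v = tgtBP P w := by
  unfold tgtBP
  split_ifs
  · rfl
  · exact compileDet_congr (symHess_vars hP) hvw

section Perfect

variable (hblock : ∀ (n₀ d : ℕ) (Lsym : ℕ → ℕ → List (List ℕ)),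
      (∀ j l : ℕ, j = l + 1 → Lsym j l = [[]]) →
      (∀ j l : ℕ, l + 1 < j → Lsym j l = []) →
      (∀ j l : ℕ, j ≤ l → ∀ μ ∈ Lsym j l, ∀ x ∈ μ, x < n₀) →
      RandPoly.PerfExt n₀ (n₀ + RandPoly.pos d d) (blockOf n₀ d Lsym)
        (fun v => (Matrix.of fun (j l : Fin (d + 1)) => RandPoly.evalP v (Lsym j.val l.val)).det))
include hblock

/-- **The block of one program is a perfect extension of its target** (from the one-block perfectness `hblock`;
the empty program by `compile_perfExt_of_const`). [cite: IshaiKushilevitz2002, §3] [cite: ApplebaumIshaiKushilevitz2006, §4.2] -/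
theorem perfExt_blockBP (n : ℕ) {P : List (List (Bool × List ℕ))} (hP : ∀ row ∈ P, ∀ a ∈ row, ∀ x ∈ a.2, x < n) :
    PerfExt n (n + freshBP P) (blockBP n P) (tgtBP P) := by
  unfold freshBP blockBP tgtBP
  cases P with
  | nil =>
    simp only [List.isEmpty_nil, ↓reduceIte, Nat.add_zero]
    exact compile_perfExt_of_const (fun _ _ => rfl) (fun v w => by simp [evalM, evalP])
  | cons r rs =>
    simp only [List.isEmpty_cons, Bool.false_eq_true, ↓reduceIte]
    exact hblock n _ _ (symHess_subdiag _) (symHess_below _) (fun j l _ => symHess_vars hP j l)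

/-- **The compiled map is a perfect extension of the list of targets**, fresh variables `[n, (compileAux n Ps).1)`,
for programs with variables below `ℓ ≤ n`. [cite: ApplebaumIshaiKushilevitz2006, §4 (concatenation)]
[cite: DvirGutfreundRothblumVadhan2010, Thm. 4.5] -/
theorem perfExt_compileAux {ℓ : ℕ} (n : ℕ) (hℓn : ℓ ≤ n) (Ps : List (List (List (Bool × List ℕ))))
    (hPs : ∀ P ∈ Ps, ∀ row ∈ P, ∀ a ∈ row, ∀ x ∈ a.2, x < ℓ) :
    PerfExt n (compileAux n Ps).1 (compileAux n Ps).2 (fun v => Ps.map fun P => tgtBP P v) := by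
  induction Ps generalizing n with
  | nil => exact perfExt_nil (fun _ _ => rfl) n
  | cons P Ps ih =>
    have hPℓ : ∀ row ∈ P, ∀ a ∈ row, ∀ x ∈ a.2, x < ℓ := hPs P (by simp)
    have hP : ∀ row ∈ P, ∀ a ∈ row, ∀ x ∈ a.2, x < n := fun row hr a ha x hx => lt_of_lt_of_le (hPℓ row hr a ha x hx) hℓn
    have hPs' : ∀ P' ∈ Ps, ∀ row ∈ P', ∀ a ∈ row, ∀ x ∈ a.2, x < ℓ := fun P' hP' => hPs P' (List.mem_cons_of_mem _ hP')
    have h₁ := perfExt_blockBP hblock n hP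
    have h₂ := ih (n + freshBP P) (by omega) hPs'
    have happ := RandPoly.PerfExt.append (Nat.le_add_right n (freshBP P)) (fun v w hvw => tgtBP_congr hP hvw) h₁ h₂
      ((varsIn_blockBP hPℓ).mono fun x hx => by rcases hx with hx | hx <;> omega)
      ((varsIn_compileAux (n + freshBP P) (by omega) Ps hPs').mono fun x hx => by
        rcases hx with hx | hx
        · exact Or.inl (lt_of_lt_of_le hx hℓn)
        · exact Or.inr hx.1)
    show PerfExt n (compileAux (n + freshBP P) Ps).1 (blockBP n P ++ (compileAux (n + freshBP P) Ps).2) _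
    refine happ.congr_target fun v w => ?_
    simp only [List.map_cons, List.cons.injEq, Prod.mk.injEq]

end Perfect


/-! ### Entropy of a perfect extension of a general source map -/

/-- **Fibres of a perfect extension of a general map.** For `P' = toFinMap (n+m) O`, `O` a perfect extension with
fresh variables `[n, n+m)` of a valuation-level target `f` that reads a map `g` on `F₂ⁿ` off the prefix
(`f (valOf (y ++ s)) = g y`), the fibre of `P' ∘ append` through `(x, r)` has the size of the fibre of `g` through
`x`.  (The tree's `RandPoly.card_fiber_eq_of_perfExt` is the case `g = P.eval`, `f = evalM · (natOf P)`.)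
[cite: DvirGutfreundRothblumVadhan2010, Thm 4.6 (proof)] -/
theorem compile_card_fiber_eq_of_perfExt {n m : ℕ} {β : Type} [DecidableEq β] (g : (Fin n → ZMod 2) → β)
    {f : (ℕ → ZMod 2) → β} (hfg : ∀ (y : Fin n → ZMod 2) (s : Fin m → ZMod 2), f (valOf (Fin.append y s)) = g y)
    {O : List (List (List ℕ))} (hO : VarsIn (fun x => x < n + m) O) (hPE : PerfExt n (n + m) O f)
    (x : Fin n → ZMod 2) (r : Fin m → ZMod 2) :
    (fiber univ ((toFinMap (n + m) O hO).eval ∘ Fin.appendEquiv n m)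
        (((toFinMap (n + m) O hO).eval ∘ Fin.appendEquiv n m) (x, r))).card =
      (fiber univ g (g x)).card := by
  -- adapted from Literature/Computability/Complexity/DegreeThreeEncodingEntropy.lean (`card_fiber_eq_of_perfExt`)
  set P' := toFinMap (n + m) O hO with hP'
  have hev : ∀ (y : Fin n → ZMod 2) (s : Fin m → ZMod 2),
      (P'.eval ∘ Fin.appendEquiv n m) (y, s) = evalM (valOf (Fin.append y s)) O := by
    intro y s
    show P'.eval (Fin.append y s) = _
    rw [eval_eq_evalM, hP', natOf_toFinMap]
  refine Finset.card_bij (fun (a : (Fin n → ZMod 2) × (Fin m → ZMod 2)) _ => a.1) (fun a ha => ?_)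
    (fun a₁ ha₁ a₂ ha₂ heq => ?_) (fun y hy => ?_)
  · -- into the fibre of `g`: decodability
    obtain ⟨y, s⟩ := a
    rw [mem_fiber] at ha ⊢
    refine ⟨mem_univ _, ?_⟩
    have h1 := hPE.dec (valOf (Fin.append y s)) (valOf (Fin.append x r)) (by rw [← hev, ← hev]; exact ha.2)
    rwa [hfg, hfg] at h1
  · -- injective: same prefix and same outputs force the same fresh block
    obtain ⟨y₁, s₁⟩ := a₁
    obtain ⟨y₂, s₂⟩ := a₂
    simp only at heq
    subst heq
    rw [mem_fiber] at ha₁ ha₂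
    have he : evalM (valOf (Fin.append y₁ s₁)) O = evalM (valOf (Fin.append y₁ s₂)) O := by
      rw [← hev, ← hev, ha₁.2, ha₂.2]
    have hag := hPE.inj _ _ (agreeBelow_valOf_append y₁ s₁ s₂) he
    refine Prod.ext rfl (funext fun j => ?_)
    have := hag (n + j.val) (by omega)
    rwa [valOf_append_add, valOf_append_add] at this
  · -- surjective: range
    rw [mem_fiber] at hy
    have ht : f (valOf (Fin.append x r)) = f (valOf (Fin.append y r)) := by rw [hfg, hfg, hy.2]
    obtain ⟨u, huw, hue⟩ := hPE.range _ _ ht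
    refine ⟨(y, fun j => u (n + j.val)), ?_, rfl⟩
    rw [mem_fiber]
    refine ⟨mem_univ _, ?_⟩
    rw [hev, hev, ← hue]
    refine evalM_congr_of_varsIn hO fun i hi => ?_
    by_cases hin : i < n
    · rw [valOf_append_of_lt y _ hin, ← valOf_append_of_lt y r hin]
      exact (huw i hin).symm
    · obtain ⟨j, rfl⟩ : ∃ j, i = n + j := ⟨i - n, by omega⟩
      exact valOf_append_add y (fun j => u (n + j.val)) ⟨j, by omega⟩

/-- **Entropy of a perfect extension of a general map**: `H(P'(U_{n+m})) = H(g(U_n)) + m`.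
[cite: DvirGutfreundRothblumVadhan2010, Thm 4.6 (proof)] -/
theorem compile_entropy_toFinMap_of_perfExt {n m : ℕ} {β : Type} [DecidableEq β] (g : (Fin n → ZMod 2) → β)
    {f : (ℕ → ZMod 2) → β} (hfg : ∀ (y : Fin n → ZMod 2) (s : Fin m → ZMod 2), f (valOf (Fin.append y s)) = g y)
    {O : List (List (List ℕ))} (hO : VarsIn (fun x => x < n + m) O) (hPE : PerfExt n (n + m) O f) :
    (toFinMap (n + m) O hO).entropy = mapEntropy univ g + m := by
  unfold PolyMapF2.entropy
  rw [← mapEntropy_univ_comp_equiv (Fin.appendEquiv n m),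
    mapEntropy_eq_add_of_card_fiber _ g (compile_card_fiber_eq_of_perfExt g hfg hO hPE)]
  congr 1
  rw [Fintype.card_fun, ZMod.card, Fintype.card_fin, Nat.cast_pow, Nat.cast_ofNat,
    Real.logb_pow, Real.logb_self_eq_one (by norm_num), mul_one]

/-! ### The targets of the presented programs are the program values -/

/-- **The target of a presented program at the valuation of an input is the value of the program.**
[cite: IshaiKushilevitz2002, §3] -/
theorem tgtBP_natBP {ℓ : ℕ} (P : AffBP ℓ) (y : Fin ℓ → ZMod 2) : tgtBP (natBP P) (valOf y) = P.eval y := by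
  cases P with
  | nil =>
    rw [compile_eval_nil]
    rfl
  | cons r rs =>
    have h1 : ¬ ((natBP (r :: rs)).isEmpty = true) := fun h => by simp [natBP] at h
    rw [tgtBP, if_neg h1, compileDet_congr_dim (M := (r :: rs).length) (by simp), compileDet_symHess_natBP]

/-- The valuation of an appended vector agrees with the valuation of the prefix below `n`. [folklore] -/
theorem compile_agreeBelow_valOf_append {n m : ℕ} (y : Fin n → ZMod 2) (s : Fin m → ZMod 2) :
    AgreeBelow n (valOf (Fin.append y s)) (valOf y) := fun i hi => by
  rw [valOf_append_of_lt y s hi, valOf, dif_pos hi]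

/-- **The list of targets of the presented programs at (an extension of) the valuation of an input is the output
word of the multi-output program.** [cite: ApplebaumIshaiKushilevitz2006, §4.2] -/
theorem map_tgtBP_valOf_append {ℓ m : ℕ} (F : AffBPMap ℓ) (y : Fin ℓ → ZMod 2) (s : Fin m → ZMod 2) :
    (natBPs F).map (fun P => tgtBP P (valOf (Fin.append y s))) = F.eval y := by
  simp only [natBPs, AffBPMap.eval, List.map_map]
  refine List.map_congr_left fun P _ => ?_
  simp only [Function.comp_apply]
  rw [tgtBP_congr (natBP_vars P) (compile_agreeBelow_valOf_append y s), tgtBP_natBP]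

/-! ### The compiled instance -/

/-- **The compiled instance has degree `≤ 3`.** [cite: IshaiKushilevitz2002, §3] -/
theorem degLE_compileInst (I : BPEAInst) : PolyMapF2.DegLE 3 (compileInst I).2.1 := by
  intro p hp μ hμ
  obtain ⟨q, hq, ν, hν, hμν⟩ := mem_toFinMap hp hμ
  have := length_le_three_compileAux I.1 (natBPs I.2.1) hq hν
  rw [← hμν, List.length_map] at this
  exact this

section Perfect

variable (hblock : ∀ (n₀ d : ℕ) (Lsym : ℕ → ℕ → List (List ℕ)),
      (∀ j l : ℕ, j = l + 1 → Lsym j l = [[]]) →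
      (∀ j l : ℕ, l + 1 < j → Lsym j l = []) →
      (∀ j l : ℕ, j ≤ l → ∀ μ ∈ Lsym j l, ∀ x ∈ μ, x < n₀) →
      RandPoly.PerfExt n₀ (n₀ + RandPoly.pos d d) (blockOf n₀ d Lsym)
        (fun v => (Matrix.of fun (j l : Fin (d + 1)) => RandPoly.evalP v (Lsym j.val l.val)).det))
include hblock

/-- **Entropy of the compiled instance**: `H(p̂(U_{ℓ+s})) = H(F(U_ℓ)) + s` EXACTLY (perfectness, from `hblock`).
[cite: DvirGutfreundRothblumVadhan2010, Thm. 4.5–4.6] [cite: ApplebaumIshaiKushilevitz2006, §4.2] -/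
theorem entropy_compileInst (I : BPEAInst) :
    PolyMapF2.entropy (compileInst I).2.1 = AffBPMap.entropy I.2.1 + freshOfI I := by
  have hPE := perfExt_compileAux hblock I.1 le_rfl (natBPs I.2.1) (natBPs_vars I.2.1)
  rw [compileAux_fst_eq] at hPE
  exact compile_entropy_toFinMap_of_perfExt (AffBPMap.eval I.2.1) (fun y s => map_tgtBP_valOf_append I.2.1 y s)
    (varsIn_compileAux_natBPs I) hPE

/-- **YES-instances of `BPEA` compile to YES-instances of `PEA 3`.** [cite: DvirGutfreundRothblumVadhan2010, Thm. 4.5] -/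
theorem compileInst_mem_yes {I : BPEAInst} (hI : BPEAInst.encoding.encode I ∈ BPEA.yes) :
    PEAInst.encoding.encode (compileInst I) ∈ (PEA 3).yes := by
  have hI' : (I.2.2 : ℝ) + 1 ≤ AffBPMap.entropy I.2.1 := (BPEAInst.encoding.mem_toLanguage_iff _ I).1 hI
  rw [encode_mem_PEA_yes_iff]
  refine ⟨degLE_compileInst I, ?_⟩
  rw [entropy_compileInst hblock]
  have : ((compileInst I).2.2 : ℝ) = I.2.2 + freshOfI I := by simp [compileInst]
  rw [this]
  linarith

/-- **NO-instances of `BPEA` compile to NO-instances of `PEA 3`.** [cite: DvirGutfreundRothblumVadhan2010, Thm. 4.5] -/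
theorem compileInst_mem_no {I : BPEAInst} (hI : BPEAInst.encoding.encode I ∈ BPEA.no) :
    PEAInst.encoding.encode (compileInst I) ∈ (PEA 3).no := by
  have hI' : AffBPMap.entropy I.2.1 ≤ (I.2.2 : ℝ) := (BPEAInst.encoding.mem_toLanguage_iff _ I).1 hI
  rw [encode_mem_PEA_no_iff]
  refine ⟨degLE_compileInst I, ?_⟩
  rw [entropy_compileInst hblock]
  have : ((compileInst I).2.2 : ℝ) = I.2.2 + freshOfI I := by simp [compileInst]
  rw [this]
  linarith

end Perfect

end Summit.PneNP.PneNP.Cruxes.PeaWorstToAvg.DualModeCompile
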